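import Literature.NumberTheory.LFunctions.ExplicitFormulaPsiCharLogDeriv
import Literature.Analysis.Complex.RectangleCauchyDerivatives
import HarnessLib

/-!
# The truncated explicit formula for `ψ(x, χ)`: the contour (Montgomery–Vaughan Thm. 12.10, residues)

Topic `Literature/NumberTheory/LFunctions`. THEOREMS (everything proved). The complex-analytic half
of the proof of the truncated explicit formula for `ψ(x, χ)` (Montgomery–Vaughan, *Multiplicative
Number Theory I*, Thm. 12.10; the named fact
`Literature.NumberTheory.LFunctions.truncatedExplicitFormula_psiChar` of `ExplicitFormulaPsiChar.lean`),
for the Perron integrand `G_x(s) = (−L'/L(s, χ)) x^s/s` of a primitive character `χ` modulo `q > 1`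
(so that `L(s, χ)` is entire):

* `contour_identity_left` — Cauchy's residue theorem on `[−2K−1/2, −1/2] × [−T, T]`: the only poles
  are the trivial zeros `−(2k + 2 − a)`, `k < K` (`a ∈ {0, 1}` the parity), all simple
  (`ExplicitPsiChar.zeroOrder_trivialZero`), with residues `x^{−(2k+2−a)}/(2k+2−a)`;
* `contour_identity_right` — on `[−1/2, b] × [−T, T]` (`b > 1`, `T` the ordinate of no zero): the
  poles are the non-trivial zeros `ρ` with `|γ| ≤ T` (residues `−m(ρ) x^ρ/ρ`, summing to
  `−charZeroSumTrunc χ x T`) and `s = 0`, where, writing `L(s, χ) = s^{m₀} h(s)` with `h(0) ≠ 0`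
  (`m₀ = 1`, `h = L(s, χ)/s` for even `χ`; `m₀ = 0`, `h = L` for odd `χ`), the residue of `G_x` is
  `−(m₀ log x + h'/h(0))` (MV p. 404: the double pole of `L'/L(s, χ) x^s/s` at `0` for even `χ`);
  since `L(s, χ)` may have real zeros in `(0, 1)`, the strip `|Im s| ≤ δ` is cut at `Re s = ±r`
  with `r, δ` below the size of the smallest non-trivial zero;
* `contour_identity` — the whole rectangle `[−2K−1/2, b] × [−T, T]`;
* `tendsto_farLeft`, `rightEdge_identity` — `K → ∞`: the far-left edge tends to `0`
  (`ExplicitPsiChar.exists_norm_logDeriv_LFunction_farLeft_le`) and the trivial zeros sum to a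
  series `V` (`hasSum_trivialZeroTerm_even/odd`: `−½ log(1 − x⁻²)`, resp.
  `½ log((1 + x⁻¹)/(1 − x⁻¹))`), giving
  `i ∫_{−T}^{T} G_x(b+it) dt = 2πi (−∑_{|γ|≤T} m(ρ)x^ρ/ρ − (m₀ log x + h'/h(0)) + V)
   − ∫_{−∞}^{b} G_x(σ − iT) dσ + ∫_{−∞}^{b} G_x(σ + iT) dσ`
  given the integrability of `G_x` on the two half-lines (supplied in the assembly file).

The proofs follow the zeta-side sibling `ExplicitFormulaPsiContour.lean` (weighted argument
principle `Literature.Analysis.Complex.integral_boundary_rect_logDeriv_mul`, Cauchy's formulae for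
the rectangle).

## References

* H. L. Montgomery, R. C. Vaughan, *Multiplicative Number Theory I. Classical Theory*, CUP 2007,
  §12.1, Thm. 12.10 (proof, p. 404). [MontgomeryVaughan2007]
-/

noncomputable section

open Complex Filter Set MeasureTheory Topology intervalIntegral Metric
open scoped Real Interval

namespace Literature.NumberTheory.LFunctions

namespace ExplicitPsiChar

open DirichletCharacter Literature.NumberTheory.LFunctions.SiegelZero ExplicitPsi PsiOneExplicit

variable {q : ℕ} [NeZero q] {χ : DirichletCharacter ℂ q}

/-! ### The integrand `G_x(s) = (−L'/L(s, χ)) x^s/s` -/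

/-- `L(s, χ)` (`χ ≠ χ₀`) is analytic everywhere. [folklore] -/
theorem analyticAt_LFunction (hχ : χ ≠ 1) (z : ℂ) : AnalyticAt ℂ χ.LFunction z :=
  (differentiable_LFunction hχ).analyticAt z

/-- `s ↦ L'/L(s, χ)` is differentiable at every `z` with `L(z, χ) ≠ 0` (`χ ≠ χ₀`). [folklore] -/
theorem differentiableAt_logDeriv_LFunction (hχ : χ ≠ 1) {z : ℂ} (hL : χ.LFunction z ≠ 0) :
    DifferentiableAt ℂ (fun s ↦ logDeriv χ.LFunction s) z := by
  have hd : DifferentiableAt ℂ (deriv χ.LFunction) z := (analyticAt_LFunction hχ z).deriv.differentiableAt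
  simp_rw [logDeriv_apply]
  exact hd.div (differentiable_LFunction hχ z) hL

/-- The integrand `G_x(s) = (−L'/L(s, χ)) x^s/s` is differentiable at every `z ≠ 0` with
`L(z, χ) ≠ 0`. [folklore] -/
theorem differentiableAt_integrand (hχ : χ ≠ 1) {x : ℝ} (hx : 0 < x) {z : ℂ} (hL : χ.LFunction z ≠ 0)
    (h0 : z ≠ 0) :
    DifferentiableAt ℂ (fun s : ℂ ↦ (-logDeriv χ.LFunction s) * ((x : ℂ) ^ s / s)) z :=
  (differentiableAt_logDeriv_LFunction hχ hL).neg.mul (differentiableAt_cpow_div hx h0)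

/-- Continuity of the integrand at every `z ≠ 0` with `L(z, χ) ≠ 0`. [folklore] -/
theorem continuousAt_integrand (hχ : χ ≠ 1) {x : ℝ} (hx : 0 < x) {z : ℂ} (hL : χ.LFunction z ≠ 0)
    (h0 : z ≠ 0) :
    ContinuousAt (fun s : ℂ ↦ (-logDeriv χ.LFunction s) * ((x : ℂ) ^ s / s)) z :=
  (differentiableAt_integrand hχ hx hL h0).continuousAt

/-- The integrand is `−1` times `(L'/L) · x^s/s`. [folklore] -/
theorem integrand_eq_neg_mul (χ : DirichletCharacter ℂ q) (x : ℝ) :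
    (fun s : ℂ ↦ (-logDeriv χ.LFunction s) * ((x : ℂ) ^ s / s)) =
      fun s ↦ (-1) * (deriv χ.LFunction s / χ.LFunction s * ((x : ℂ) ^ s / s)) := by
  funext s; rw [logDeriv_apply]; ring

/-! ### A positive lower bound for finitely many positive quantities -/

/-- For a finite set `S` and a function `f` positive on `S` there is `ε > 0` with `ε ≤ f` on `S`.
[folklore] -/
theorem exists_pos_forall_le_of_finite {S : Set ℂ} (hS : S.Finite) (f : ℂ → ℝ)
    (hf : ∀ ρ ∈ S, 0 < f ρ) : ∃ ε : ℝ, 0 < ε ∧ ∀ ρ ∈ S, ε ≤ f ρ := by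
  classical
  rcases S.eq_empty_or_nonempty with h | h
  · exact ⟨1, one_pos, fun ρ hρ ↦ by rw [h] at hρ; exact absurd hρ (Set.notMem_empty ρ)⟩
  · have hne : hS.toFinset.Nonempty := by simpa using h
    obtain ⟨ρ₀, hρ₀, hmin⟩ := hS.toFinset.exists_min_image f hne
    rw [Set.Finite.mem_toFinset] at hρ₀
    exact ⟨f ρ₀, hf ρ₀ hρ₀, fun ρ hρ ↦ hmin ρ ((Set.Finite.mem_toFinset hS).2 hρ)⟩

/-! ### The contour identity on `[−2K−1/2, −1/2] × [−T, T]`: the trivial zeros -/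

/-- **The contour identity in `Re s ≤ −1/2`.** For a primitive `χ` mod `q > 1` with Gamma factor
`Γ_ℝ(s + a)` (`a ∈ {0, 1}`), `x > 0`, `K ≥ 1`, `T ≥ 1`:
`∮_{∂([−2K−1/2, −1/2] × [−T, T])} (−L'/L)(s, χ) x^s/s ds = 2πi ∑_{k<K} x^{−(2k+2−a)}/(2k+2−a)`
(weighted argument principle for `L(s, χ)` at the trivial zeros `−(2k + 2 − a)`, which are simple;
nothing off the axis). [cite: MontgomeryVaughan2007, Thm. 12.10 (proof)] -/
theorem contour_identity_left (hprim : χ.IsPrimitive) (hq : 1 < q) {x : ℝ} (hx : 0 < x) {K : ℕ}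
    (hK : 1 ≤ K) {T : ℝ} (hT : 1 ≤ T) {a : ℝ} (ha : a = 0 ∨ a = 1)
    (hGa : ∀ s : ℂ, gammaFactor χ s = Gammaℝ (s + a)) :
    Literature.Analysis.Complex.rectBoundaryIntegral
        (fun s : ℂ ↦ (-logDeriv χ.LFunction s) * ((x : ℂ) ^ s / s))
        (-(2 * (K : ℝ)) - 1 / 2) (-(1 / 2)) (-T) T =
      2 * π * I * ∑ k ∈ Finset.range K,
        (x : ℂ) ^ (-(2 * (k : ℂ) + 2 - a)) / (2 * (k : ℂ) + 2 - a) := by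
  have hχ : χ ≠ 1 := ne_one_of_isPrimitive hprim hq
  have hK1 : (1 : ℝ) ≤ K := by exact_mod_cast hK
  have ha01 : 0 ≤ a ∧ a ≤ 1 := by rcases ha with rfl | rfl <;> norm_num
  set aK : ℝ := -(2 * (K : ℝ)) - 1 / 2 with haK
  set P : ℂ → ℂ := fun s ↦ deriv χ.LFunction s / χ.LFunction s * ((x : ℂ) ^ s / s) with hP
  have hab : aK < -(1 / 2) := by rw [haK]; linarith
  -- the abscissae `aK` and `-1/2` are not integers
  have hnot : ∀ (r : ℝ), (r = aK ∨ r = -(1 / 2)) → ∀ m : ℤ, r ≠ m := by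
    intro r hr m h
    rcases hr with rfl | rfl
    · have h2 : (2 : ℝ) * (-(m : ℝ) - 2 * K) = 1 := by rw [haK] at h; linarith
      have h3 : (2 * (-(m : ℤ) - 2 * K) : ℤ) = 1 := by exact_mod_cast h2
      omega
    · have h2 : (2 : ℝ) * (-(m : ℝ)) = 1 := by linarith
      have h3 : (2 * (-(m : ℤ)) : ℤ) = 1 := by exact_mod_cast h2
      omega
  -- `L ≠ 0` at the relevant points of `Re z ≤ -1/2`
  have hLne : ∀ z : ℂ, z.re ≤ -(1 / 2) → (z.im ≠ 0 ∨ (z.re = aK ∨ z.re = -(1 / 2))) →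
      χ.LFunction z ≠ 0 := by
    intro z hre hz
    rcases hz with hz | hz
    · exact LFunction_ne_zero_of_re_nonpos_of_im_ne_zero hprim hχ (by linarith) hz
    · exact LFunction_ne_zero_of_re_nonpos_of_gammaFactor_ne_zero hprim hχ (by linarith)
        (gammaFactor_ne_zero_of_not_int χ (hnot z.re hz))
  have hPdiff : ∀ z : ℂ, z.re ≤ -(1 / 2) → (z.im ≠ 0 ∨ (z.re = aK ∨ z.re = -(1 / 2))) →
      DifferentiableAt ℂ P z := by
    intro z hre hz
    have h0 : z ≠ 0 := fun h ↦ by rw [h] at hre; simp only [zero_re] at hre; linarith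
    have h := differentiableAt_logDeriv_LFunction hχ (hLne z hre hz)
    simp_rw [logDeriv_apply] at h
    exact h.mul (differentiableAt_cpow_div hx h0)
  have hcontP : ∀ z : ℂ, z.re ≤ -(1 / 2) → (z.im ≠ 0 ∨ (z.re = aK ∨ z.re = -(1 / 2))) →
      ContinuousAt P z := fun z hre hz ↦ (hPdiff z hre hz).continuousAt
  have hiv : ∀ (r : ℝ), (r = aK ∨ r = -(1 / 2)) → ∀ c d : ℝ, c ≤ d →
      IntervalIntegrable (fun y : ℝ ↦ P ((r : ℂ) + y * I)) volume c d := by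
    intro r hr c d hcd
    refine Literature.Analysis.Complex.intervalIntegrable_of_continuousAt_vertical r hcd
      fun y _ ↦ hcontP _ ?_ ?_
    · simp; rcases hr with rfl | rfl <;> linarith
    · right; simp; rcases hr with h | h <;> simp [h]
  -- `G = -P`
  rw [integrand_eq_neg_mul, Literature.Analysis.Complex.rectBoundaryIntegral_const_mul]
  change -1 * Literature.Analysis.Complex.rectBoundaryIntegral P aK (-(1 / 2)) (-T) T = _
  -- cut horizontally at `±1/2`
  rw [ZetaZeroSum.rectBoundaryIntegral_split (e := -(1 / 2)) (hiv _ (Or.inl rfl) _ _ (by linarith))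
      (hiv _ (Or.inl rfl) _ _ (by linarith)) (hiv _ (Or.inr rfl) _ _ (by linarith))
      (hiv _ (Or.inr rfl) _ _ (by linarith)),
    ZetaZeroSum.rectBoundaryIntegral_split (c := -(1 / 2)) (e := 1 / 2) (d := T)
      (hiv _ (Or.inl rfl) _ _ (by linarith)) (hiv _ (Or.inl rfl) _ _ (by linarith))
      (hiv _ (Or.inr rfl) _ _ (by linarith)) (hiv _ (Or.inr rfl) _ _ (by linarith))]
  -- the two outer strips carry nothing
  have houter : ∀ c d : ℝ, c ≤ d → (0 < c ∨ d < 0) →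
      Literature.Analysis.Complex.rectBoundaryIntegral P aK (-(1 / 2)) c d = 0 := by
    intro c d hcd h0
    refine Literature.Analysis.Complex.rectBoundaryIntegral_eq_zero_of_differentiableOn hab.le hcd
      fun z hz ↦ ?_
    have hre : z.re ∈ Icc aK (-(1 / 2)) := hz.1
    have him : z.im ∈ Icc c d := hz.2
    refine (hPdiff z hre.2 (Or.inl fun h ↦ ?_)).differentiableWithinAt
    rw [h] at him
    rcases h0 with h0 | h0
    · linarith [him.1]
    · linarith [him.2]
  rw [houter (-T) (-(1 / 2)) (by linarith) (Or.inr (by norm_num)),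
    houter (1 / 2) T (by linarith) (Or.inl (by norm_num)), zero_add, add_zero]
  -- the middle box: weighted argument principle
  have h0box : ∀ z ∈ Icc aK (-(1 / 2)) ×ℂ Icc (-(1 / 2) : ℝ) (1 / 2), z ≠ 0 := by
    intro z hz h
    have hre : z.re ∈ Icc aK (-(1 / 2)) := hz.1
    rw [h] at hre; simp only [mem_Icc, zero_re] at hre; linarith [hre.2]
  have key := Literature.Analysis.Complex.integral_boundary_rect_logDeriv_mul (f := χ.LFunction)
    (g := fun s : ℂ ↦ (x : ℂ) ^ s / s) hab (by norm_num : (-(1 / 2) : ℝ) < 1 / 2)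
    (fun z _ ↦ analyticAt_LFunction hχ z)
    (fun z hz ↦ analyticAt_cpow_div hx (h0box z hz))
    (fun t ht ↦ hLne _ (by simp; linarith [ht.2]) (Or.inl (by simp)))
    (fun t ht ↦ hLne _ (by simp; linarith [ht.2]) (Or.inl (by simp)))
    (fun y _ ↦ hLne _ (by simp; rw [haK]; linarith) (Or.inr (by simp)))
    (fun y _ ↦ hLne _ (by simp) (Or.inr (by simp)))
  have hmid : Literature.Analysis.Complex.rectBoundaryIntegral P aK (-(1 / 2)) (-(1 / 2)) (1 / 2) =
      2 * π * I * ∑ᶠ ρ ∈ {ρ : ℂ | χ.LFunction ρ = 0 ∧ ρ ∈ Ioo aK (-(1 / 2)) ×ℂ Ioo (-(1 / 2) : ℝ) (1 / 2)},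
        ((meromorphicOrderAt χ.LFunction ρ).untop₀ : ℂ) * ((x : ℂ) ^ ρ / ρ) := by
    rw [Literature.Analysis.Complex.rectBoundaryIntegral, ← key]
  rw [hmid]
  -- the zero set is `{-(2k+2-a) : k < K}`
  set z₀ : ℕ → ℂ := fun k ↦ -(2 * (k : ℂ) + 2 - a) with hz₀
  have hz₀re : ∀ k : ℕ, (z₀ k).re = -(2 * (k : ℝ) + 2 - a) := by intro k; simp [hz₀]
  have hz₀im : ∀ k : ℕ, (z₀ k).im = 0 := by intro k; simp [hz₀]
  have hz₀G : ∀ k : ℕ, gammaFactor χ (z₀ k) = 0 := by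
    intro k
    rw [hGa, Gammaℝ_eq_zero_iff]
    rcases ha with rfl | rfl
    · exact ⟨k + 1, by simp [hz₀]; ring⟩
    · exact ⟨k, by simp [hz₀]; ring⟩
  have hset : {ρ : ℂ | χ.LFunction ρ = 0 ∧ ρ ∈ Ioo aK (-(1 / 2)) ×ℂ Ioo (-(1 / 2) : ℝ) (1 / 2)} =
      z₀ '' ((Finset.range K : Finset ℕ) : Set ℕ) := by
    ext ρ
    simp only [mem_setOf_eq, Complex.mem_reProdIm, mem_Ioo, mem_image, Finset.coe_range, mem_Iio]
    constructor
    · rintro ⟨h0', ⟨h1, h2⟩, -, -⟩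
      have hG0 : gammaFactor χ ρ = 0 := (LFunction_eq_zero_iff_gammaFactor hprim hχ (by linarith)).1 h0'
      rw [hGa, Gammaℝ_eq_zero_iff] at hG0
      obtain ⟨n, hn⟩ := hG0
      have hρ : ρ = -(2 * (n : ℂ)) - a := eq_sub_of_add_eq hn
      have hre : ρ.re = -(2 * (n : ℝ)) - a := by rw [hρ]; simp
      rw [hre] at h1 h2
      rw [haK] at h1
      rcases ha with rfl | rfl
      · -- even: `n = k + 1`
        have hn1 : 1 ≤ n := by
          by_contra hlt; push Not at hlt
          have : n = 0 := by omega
          subst this; simp at h2; linarith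
        have hnK : n ≤ K := by
          by_contra hlt; push Not at hlt
          have : (K : ℝ) + 1 ≤ n := by exact_mod_cast hlt
          linarith
        refine ⟨n - 1, by omega, ?_⟩
        rw [hρ]
        simp only [hz₀, Nat.cast_sub hn1, Nat.cast_one]
        push_cast; ring
      · -- odd: `n = k`
        have hnK : n + 1 ≤ K := by
          by_contra hlt; push Not at hlt
          have : (K : ℝ) ≤ n := by exact_mod_cast Nat.lt_succ_iff.1 hlt
          linarith
        refine ⟨n, by omega, ?_⟩
        rw [hρ]
        simp only [hz₀]
        push_cast; ring
    · rintro ⟨k, hk, rfl⟩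
      have hkK : (k : ℝ) + 1 ≤ K := by exact_mod_cast hk
      refine ⟨(LFunction_eq_zero_iff_gammaFactor hprim hχ ?_).2 (hz₀G k), ⟨?_, ?_⟩, ?_, ?_⟩
      · rw [hz₀re]; linarith
      · rw [hz₀re, haK]; linarith
      · rw [hz₀re]; linarith [(k.cast_nonneg : (0 : ℝ) ≤ k)]
      · rw [hz₀im]; norm_num
      · rw [hz₀im]; norm_num
  have hinj : ∀ m ∈ ((Finset.range K : Finset ℕ) : Set ℕ), ∀ n ∈ ((Finset.range K : Finset ℕ) : Set ℕ),
      z₀ m = z₀ n → m = n := by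
    intro m _ n _ h
    have := congrArg Complex.re h
    rw [hz₀re, hz₀re] at this
    exact_mod_cast (by linarith : (m : ℝ) = n)
  rw [hset, finsum_mem_image hinj, finsum_mem_coe_finset, Finset.mul_sum, Finset.mul_sum,
    Finset.mul_sum]
  refine Finset.sum_congr rfl fun k _ ↦ ?_
  rw [meromorphicOrderAt_untop₀ hχ, zeroOrder_trivialZero hprim hχ (hz₀G k)]
  have hk : (2 * (k : ℂ) + 2 - a) ≠ 0 := by
    have : ((2 * (k : ℝ) + 2 - a : ℝ) : ℂ) ≠ 0 := by
      exact_mod_cast (by linarith [(k.cast_nonneg : (0 : ℝ) ≤ k)] : (2 * (k : ℝ) + 2 - a) ≠ 0)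
    simpa using this
  simp only [hz₀]
  push_cast
  field_simp

/-! ### The contour identity on `[−1/2, b] × [−T, T]`: the non-trivial zeros and the pole at `0` -/

/-- **Classification of the zeros in the right part.** For a primitive `χ` mod `q > 1`, a zero `z` of
`L(s, χ)` with `Re z ≥ −1/2` and `|Im z| ≤ T` is either `0` or a non-trivial zero of the box
`lfunctionZeroBox χ T`. [cite: MontgomeryVaughan2007, Corollary 10.8] -/
theorem zero_eq_zero_or_mem_box (hprim : χ.IsPrimitive) (hq : 1 < q) {z : ℂ} {T : ℝ}
    (hz : χ.LFunction z = 0) (hre : -(1 / 2) ≤ z.re) (him : |z.im| ≤ T) :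
    z = 0 ∨ z ∈ lfunctionZeroBox χ T := by
  have hχ : χ ≠ 1 := ne_one_of_isPrimitive hprim hq
  by_cases hG : gammaFactor χ z = 0
  · left
    rcases χ.even_or_odd with hχe | hχo
    · obtain ⟨n, hn⟩ := (gammaFactor_eq_zero_iff_of_even hχe z).1 hG
      have : z.re = -(2 * (n : ℝ)) := by rw [hn]; simp
      rw [this] at hre
      have hn0 : n = 0 := by
        by_contra h
        have : (1 : ℝ) ≤ n := by exact_mod_cast Nat.one_le_iff_ne_zero.2 h
        linarith
      rw [hn, hn0]; simp
    · obtain ⟨n, hn⟩ := (gammaFactor_eq_zero_iff_of_odd hχo z).1 hG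
      have : z.re = -(2 * (n : ℝ)) - 1 := by rw [eq_sub_of_add_eq hn]; simp
      rw [this] at hre
      linarith [(n.cast_nonneg : (0 : ℝ) ≤ n)]
  · right
    obtain ⟨h1, h2⟩ := re_mem_Ioo_of_LFunction_eq_zero hprim hχ hz hG
    exact ⟨hz, h1, h2, him⟩

set_option maxHeartbeats 3200000 in
/-- **The contour identity on `[−1/2, b] × [−T, T]`.** Let `χ` be primitive mod `q > 1`, `x > 0`,
`b > 1`, `T ≥ 1` the ordinate of no non-trivial zero (`Im ρ ≠ ±T`), and write `L(s, χ) = s^{m₀} h(s)`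
with `h` entire, `h(0) ≠ 0`. Then
`∮_{∂([−1/2, b] × [−T, T])} (−L'/L)(s, χ) x^s/s ds = 2πi (−∑_{|Im ρ| ≤ T} m(ρ) x^ρ/ρ − (m₀ log x + h'/h(0)))`
(poles at the non-trivial zeros, and at `0` where `(−L'/L) x^s/s = −m₀ x^s/s² − (h'/h) x^s/s`; the
strip `|Im s| ≤ δ` is cut at `Re s = ±r`, `r, δ` smaller than every non-trivial zero of the box).
[cite: MontgomeryVaughan2007, Thm. 12.10 (proof)] -/
theorem contour_identity_right (hprim : χ.IsPrimitive) (hq : 1 < q) {x b T : ℝ} (hx : 0 < x)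
    (hb : 1 < b) (hT : 1 ≤ T)
    (hgood : ∀ ρ : ℂ, χ.LFunction ρ = 0 → 0 < ρ.re → ρ.re < 1 → ρ.im ≠ T ∧ ρ.im ≠ -T)
    {m₀ : ℕ} {h : ℂ → ℂ} (hh : Differentiable ℂ h) (hh0 : h 0 ≠ 0)
    (hLh : ∀ s : ℂ, χ.LFunction s = s ^ m₀ * h s) :
    Literature.Analysis.Complex.rectBoundaryIntegral
        (fun s : ℂ ↦ (-logDeriv χ.LFunction s) * ((x : ℂ) ^ s / s)) (-(1 / 2)) b (-T) T =
      2 * π * I * (-(∑ ρ ∈ (lfunctionZeroBox_finite (ne_one_of_isPrimitive hprim hq) T).toFinset,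
          (DirichletDisc.zeroOrder χ ρ : ℂ) * ((x : ℂ) ^ ρ / ρ)) -
        ((m₀ : ℂ) * Real.log x + logDeriv h 0)) := by
  have hχ : χ ≠ 1 := ne_one_of_isPrimitive hprim hq
  have hT0 : (0 : ℝ) < T := by linarith
  have hb0 : (0 : ℝ) < b := by linarith
  set Z : Set ℂ := lfunctionZeroBox χ T with hZdef
  have hZfin : Z.Finite := lfunctionZeroBox_finite hχ T
  set G : ℂ → ℂ := fun s : ℂ ↦ (-logDeriv χ.LFunction s) * ((x : ℂ) ^ s / s) with hGdef
  -- Step 1: the parameters `r`, `δ`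
  obtain ⟨ε₁, hε₁, hnorm⟩ := exists_pos_forall_le_of_finite hZfin (fun ρ ↦ ‖ρ‖) fun ρ hρ ↦ by
    have : 0 < ρ.re := hρ.2.1
    exact norm_pos_iff.2 fun h0 ↦ by rw [h0] at this; simp at this
  obtain ⟨ε₂, hε₂, himZ⟩ := exists_pos_forall_le_of_finite (hZfin.subset (sep_subset Z fun ρ ↦ ρ.im ≠ 0))
    (fun ρ ↦ |ρ.im|) fun ρ hρ ↦ abs_pos.2 hρ.2
  set r : ℝ := min (1 / 4) (ε₁ / 3) with hr
  set δ : ℝ := min r (ε₂ / 2) with hδ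
  have hr0 : 0 < r := lt_min (by norm_num) (by positivity)
  have hr4 : r ≤ 1 / 4 := min_le_left _ _
  have hrε : 3 * r ≤ ε₁ := by have := min_le_right (1 / 4 : ℝ) (ε₁ / 3); rw [← hr] at this; linarith
  have hδ0 : 0 < δ := lt_min hr0 (by positivity)
  have hδr : δ ≤ r := min_le_left _ _
  have hδε : 2 * δ ≤ ε₂ := by have := min_le_right r (ε₂ / 2); rw [← hδ] at this; linarith
  have hδT : δ < T := by linarith
  have hrb : r < b := by linarith
  -- consequences for the zeros of the box
  have hZ1 : ∀ ρ ∈ Z, ρ.im = 0 ∨ δ < |ρ.im| := by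
    intro ρ hρ
    by_cases him : ρ.im = 0
    · exact Or.inl him
    · right
      have := himZ ρ ⟨hρ, him⟩
      linarith
  have hZ2 : ∀ ρ ∈ Z, ¬ (|ρ.re| ≤ r ∧ |ρ.im| ≤ δ) := by
    rintro ρ hρ ⟨h1, h2⟩
    have h3 := hnorm ρ hρ
    have h4 : ‖ρ‖ ≤ |ρ.re| + |ρ.im| := Complex.norm_le_abs_re_add_abs_im ρ
    linarith
  -- all zeros with `Re z ≥ -1/2`, `|Im z| ≤ T` are `0` or in `Z`
  have hzero : ∀ z : ℂ, χ.LFunction z = 0 → -(1 / 2) ≤ z.re → |z.im| ≤ T → z = 0 ∨ z ∈ Z :=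
    fun z hz hre him ↦ zero_eq_zero_or_mem_box hprim hq hz hre him
  -- non-vanishing on the various lines
  have hL_im : ∀ z : ℂ, -(1 / 2) ≤ z.re → (|z.im| = δ ∨ |z.im| = T) → χ.LFunction z ≠ 0 := by
    intro z hre hz h0
    have him0 : z.im ≠ 0 := by
      intro h; rw [h, abs_zero] at hz; rcases hz with hz | hz <;> linarith
    have hzT : |z.im| ≤ T := by rcases hz with hz | hz <;> linarith
    rcases hzero z h0 hre hzT with h | h
    · exact him0 (by rw [h]; simp)
    · rcases hz with hz | hz
      · rcases hZ1 z h with h' | h'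
        · exact him0 h'
        · linarith
      · obtain ⟨h1, h2⟩ := hgood z h0 h.2.1 h.2.2.1
        rcases (abs_eq hT0.le).1 hz with h' | h'
        · exact h1 h'
        · exact h2 h'
  have hL_center : ∀ z : ℂ, |z.re| ≤ r → |z.im| ≤ δ → z ≠ 0 → χ.LFunction z ≠ 0 := by
    intro z hre him h0 hz
    rcases hzero z hz (by rw [abs_le] at hre; linarith [hre.1]) (by linarith) with h | h
    · exact h0 h
    · exact hZ2 z h ⟨hre, him⟩
  have hL_left : ∀ z : ℂ, -(1 / 2) ≤ z.re → z.re ≤ -r → |z.im| ≤ δ → χ.LFunction z ≠ 0 := by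
    intro z h1 h2 him hz
    rcases hzero z hz h1 (by linarith) with h | h
    · rw [h] at h2; simp at h2; linarith
    · have : 0 < z.re := h.2.1; linarith
  have hL_b : ∀ y : ℝ, χ.LFunction ((b : ℂ) + y * I) ≠ 0 := fun y ↦
    LFunction_ne_zero_of_one_le_re χ (Or.inl hχ) (by simp; linarith)
  have hL_half : ∀ y : ℝ, |y| ≤ T → χ.LFunction ((((-(1 / 2) : ℝ)) : ℂ) + y * I) ≠ 0 := by
    intro y hy hz
    rcases hzero _ hz (by simp) (by simpa using hy) with h | h
    · have := congrArg Complex.re h; simp at this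
    · have : (0 : ℝ) < ((((-(1 / 2) : ℝ)) : ℂ) + y * I).re := h.2.1
      simp at this; linarith
  -- continuity / integrability of `G` on the edges we cut along
  have hGc : ∀ z : ℂ, χ.LFunction z ≠ 0 → z ≠ 0 → ContinuousAt G z :=
    fun z hL h0 ↦ continuousAt_integrand hχ hx hL h0
  have hiv_b : ∀ c d : ℝ, c ≤ d → IntervalIntegrable (fun y : ℝ ↦ G ((b : ℂ) + y * I)) volume c d := by
    intro c d hcd
    refine Literature.Analysis.Complex.intervalIntegrable_of_continuousAt_vertical b hcd fun y _ ↦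
      hGc _ (hL_b y) ?_
    intro h; have := congrArg Complex.re h; simp at this; linarith
  have hiv_half : ∀ c d : ℝ, -T ≤ c → c ≤ d → d ≤ T →
      IntervalIntegrable (fun y : ℝ ↦ G ((((-(1 / 2) : ℝ)) : ℂ) + y * I)) volume c d := by
    intro c d hc hcd hd
    refine Literature.Analysis.Complex.intervalIntegrable_of_continuousAt_vertical _ hcd fun y hy ↦
      hGc _ (hL_half y (abs_le.2 ⟨by linarith [hy.1], by linarith [hy.2]⟩)) ?_
    intro h; have := congrArg Complex.re h; simp at this
  have hih_δ : ∀ (e : ℝ), (e = -δ ∨ e = δ) → ∀ c d : ℝ, -(1 / 2) ≤ c → c ≤ d →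
      IntervalIntegrable (fun t : ℝ ↦ G ((t : ℂ) + e * I)) volume c d := by
    intro e he c d hc hcd
    refine Literature.Analysis.Complex.intervalIntegrable_of_continuousAt_horizontal e hcd fun t ht ↦
      hGc _ (hL_im _ (by simp; linarith [ht.1]) (Or.inl ?_)) ?_
    · rcases he with rfl | rfl <;> simp [abs_of_pos hδ0]
    · intro h; have := congrArg Complex.im h; simp at this
      rcases he with rfl | rfl <;> linarith
  -- Step 2: cut horizontally at `±δ`
  have hab : (-(1 / 2) : ℝ) ≤ b := by linarith
  rw [ZetaZeroSum.rectBoundaryIntegral_split (e := -δ) (hiv_half _ _ (by linarith) (by linarith) (by linarith))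
      (hiv_half _ _ (by linarith) (by linarith) le_rfl) (hiv_b _ _ (by linarith)) (hiv_b _ _ (by linarith)),
    ZetaZeroSum.rectBoundaryIntegral_split (c := -δ) (e := δ) (d := T)
      (hiv_half _ _ (by linarith) (by linarith) (by linarith)) (hiv_half _ _ (by linarith) (by linarith) le_rfl)
      (hiv_b _ _ (by linarith)) (hiv_b _ _ (by linarith))]
  -- and the middle strip vertically at `±r`
  rw [rectBoundaryIntegral_vsplit (F := G) (a := -(1 / 2)) (e := -r) (b := b) (c := -δ) (d := δ)
      (hih_δ _ (Or.inl rfl) _ _ le_rfl (by linarith)) (hih_δ _ (Or.inl rfl) _ _ (by linarith) (by linarith))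
      (hih_δ _ (Or.inr rfl) _ _ le_rfl (by linarith)) (hih_δ _ (Or.inr rfl) _ _ (by linarith) (by linarith)),
    rectBoundaryIntegral_vsplit (F := G) (a := -r) (e := r) (b := b) (c := -δ) (d := δ)
      (hih_δ _ (Or.inl rfl) _ _ (by linarith) (by linarith)) (hih_δ _ (Or.inl rfl) _ _ (by linarith) (by linarith))
      (hih_δ _ (Or.inr rfl) _ _ (by linarith) (by linarith)) (hih_δ _ (Or.inr rfl) _ _ (by linarith) (by linarith))]
  -- Step 3a: the outer strips and the right-middle box by the weighted argument principle
  set f : ℂ → ℂ := fun ρ ↦ ((meromorphicOrderAt χ.LFunction ρ).untop₀ : ℂ) * ((x : ℂ) ^ ρ / ρ) with hf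
  have hWAP : ∀ a' b' c d : ℝ, a' < b' → c < d → (0 < c ∨ d < 0 ∨ 0 < a') →
      (∀ t ∈ Icc a' b', χ.LFunction (t + c * I) ≠ 0) → (∀ t ∈ Icc a' b', χ.LFunction (t + d * I) ≠ 0) →
      (∀ y ∈ Icc c d, χ.LFunction (a' + y * I) ≠ 0) → (∀ y ∈ Icc c d, χ.LFunction (b' + y * I) ≠ 0) →
      Literature.Analysis.Complex.rectBoundaryIntegral G a' b' c d =
        (-1) * (2 * π * I * ∑ᶠ ρ ∈ {ρ : ℂ | χ.LFunction ρ = 0 ∧ ρ ∈ Ioo a' b' ×ℂ Ioo c d}, f ρ) := by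
    intro a' b' c d hab' hcd h0 hbot htop hleft hright
    have him : ∀ z ∈ Icc a' b' ×ℂ Icc c d, z ≠ 0 := by
      intro z hz h
      have h1 : z.im ∈ Icc c d := hz.2
      have h2 : z.re ∈ Icc a' b' := hz.1
      rw [h] at h1 h2; simp at h1 h2
      rcases h0 with h0 | h0 | h0
      · linarith [h1.1]
      · linarith [h1.2]
      · linarith [h2.1]
    have key := Literature.Analysis.Complex.integral_boundary_rect_logDeriv_mul (f := χ.LFunction)
      (g := fun s : ℂ ↦ (x : ℂ) ^ s / s) hab' hcd (fun z _ ↦ analyticAt_LFunction hχ z)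
      (fun z hz ↦ analyticAt_cpow_div hx (him z hz)) hbot htop hleft hright
    rw [hGdef, integrand_eq_neg_mul, Literature.Analysis.Complex.rectBoundaryIntegral_const_mul,
      Literature.Analysis.Complex.rectBoundaryIntegral, key]
  have him_line : ∀ (t e : ℝ), ((t : ℂ) + e * I).im = e := by intro t e; simp
  have hre_line : ∀ (t : ℝ) (y : ℝ), ((t : ℂ) + y * I).re = t := by intro t y; simp
  -- top strip
  rw [hWAP (-(1 / 2)) b δ T (by linarith) hδT (Or.inl hδ0)
      (fun t ht ↦ hL_im _ (by rw [hre_line]; exact ht.1) (Or.inl (by rw [him_line, abs_of_pos hδ0])))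
      (fun t ht ↦ hL_im _ (by rw [hre_line]; exact ht.1) (Or.inr (by rw [him_line, abs_of_pos hT0])))
      (fun y hy ↦ hL_half y (abs_le.2 ⟨by linarith [hy.1], hy.2⟩))
      (fun y _ ↦ hL_b y)]
  -- bottom strip
  rw [hWAP (-(1 / 2)) b (-T) (-δ) (by linarith) (by linarith) (Or.inr (Or.inl (by linarith)))
      (fun t ht ↦ hL_im _ (by rw [hre_line]; exact ht.1) (Or.inr (by rw [him_line, abs_neg, abs_of_pos hT0])))
      (fun t ht ↦ hL_im _ (by rw [hre_line]; exact ht.1) (Or.inl (by rw [him_line, abs_neg, abs_of_pos hδ0])))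
      (fun y hy ↦ hL_half y (abs_le.2 ⟨hy.1, by linarith [hy.2]⟩))
      (fun y _ ↦ hL_b y)]
  -- right-middle box
  rw [hWAP r b (-δ) δ hrb (by linarith) (Or.inr (Or.inr hr0))
      (fun t ht ↦ hL_im _ (by rw [hre_line]; linarith [ht.1]) (Or.inl (by rw [him_line, abs_neg, abs_of_pos hδ0])))
      (fun t ht ↦ hL_im _ (by rw [hre_line]; linarith [ht.1]) (Or.inl (by rw [him_line, abs_of_pos hδ0])))
      (fun y hy ↦ hL_center _ (by rw [hre_line, abs_of_pos hr0]) (by rw [him_line]; exact abs_le.2 hy)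
        (fun h ↦ by have := congrArg Complex.re h; simp at this; linarith))
      (fun y _ ↦ hL_b y)]
  -- Step 3b: the left-middle box carries nothing
  have hleftmid : Literature.Analysis.Complex.rectBoundaryIntegral G (-(1 / 2)) (-r) (-δ) δ = 0 := by
    refine Literature.Analysis.Complex.rectBoundaryIntegral_eq_zero_of_differentiableOn (by linarith)
      (by linarith) fun z hz ↦ ?_
    have hre : z.re ∈ Icc (-(1 / 2)) (-r) := hz.1
    have him : z.im ∈ Icc (-δ) δ := hz.2
    have h0 : z ≠ 0 := fun h ↦ by rw [h] at hre; simp only [mem_Icc, zero_re] at hre; linarith [hre.2]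
    exact (differentiableAt_integrand hχ hx (hL_left z hre.1 hre.2 (abs_le.2 him)) h0).differentiableWithinAt
  rw [hleftmid]
  -- Step 3c: the centre box: the pole at `0`
  have hcenter : Literature.Analysis.Complex.rectBoundaryIntegral G (-r) r (-δ) δ =
      2 * π * I * (-((m₀ : ℂ) * Real.log x + logDeriv h 0)) := by
    -- `h ≠ 0` on the closed box
    have hh_ne : ∀ z ∈ Icc (-r) r ×ℂ Icc (-δ) δ, h z ≠ 0 := by
      intro z hz
      by_cases h0 : z = 0
      · rw [h0]; exact hh0
      · have hL := hL_center z (abs_le.2 hz.1) (abs_le.2 hz.2) h0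
        rw [hLh z] at hL
        exact right_ne_zero_of_mul hL
    -- `logDeriv L = m₀/s + logDeriv h` off `0` where `h ≠ 0`
    have hLfun : χ.LFunction = fun s ↦ s ^ m₀ * h s := funext hLh
    have hlogL : ∀ s : ℂ, s ≠ 0 → h s ≠ 0 →
        logDeriv χ.LFunction s = (m₀ : ℂ) / s + logDeriv h s := by
      intro s hs hhs
      rw [hLfun, logDeriv_mul (f := fun z : ℂ ↦ z ^ m₀) (g := h) s (pow_ne_zero _ hs) hhs
        (differentiableAt_pow m₀) (hh s), logDeriv_pow]
    -- the decomposition of `G` on the boundary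
    set G₁ : ℂ → ℂ := fun s ↦ (x : ℂ) ^ s / (s - 0) ^ (1 + 1) with hG₁
    set G₂ : ℂ → ℂ := fun s ↦ (-1) * ((logDeriv h s * (x : ℂ) ^ s) / (s - 0)) with hG₂
    have hsplit : ∀ s : ℂ, s ≠ 0 → h s ≠ 0 → G s = (-(m₀ : ℂ)) * G₁ s + G₂ s := by
      intro s hs hhs
      simp only [hGdef, hG₁, hG₂, sub_zero]
      rw [hlogL s hs hhs]
      field_simp
      ring
    -- boundary points are `≠ 0` and in the closed box
    have hbdry : ∀ z ∈ Icc (-r) r ×ℂ Icc (-δ) δ, (z.im = -δ ∨ z.im = δ ∨ z.re = -r ∨ z.re = r) →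
        z ≠ 0 ∧ h z ≠ 0 := by
      intro z hz hz'
      refine ⟨fun h0 ↦ ?_, hh_ne z hz⟩
      rw [h0] at hz'; simp at hz'
      rcases hz' with h | h | h | h <;> linarith
    have hmem : ∀ (t : ℝ), t ∈ Icc (-r) r → ∀ (e : ℝ), (e = -δ ∨ e = δ) →
        ((t : ℂ) + e * I) ∈ Icc (-r) r ×ℂ Icc (-δ) δ := by
      intro t ht e he
      refine ⟨by simpa using ht, ?_⟩
      rcases he with rfl | rfl <;> simp [hδ0.le]
    have hmem' : ∀ (y : ℝ), y ∈ Icc (-δ) δ → ∀ (t : ℝ), (t = -r ∨ t = r) →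
        ((t : ℂ) + y * I) ∈ Icc (-r) r ×ℂ Icc (-δ) δ := by
      intro y hy t ht
      refine ⟨?_, by simpa using hy⟩
      rcases ht with rfl | rfl <;> simp [hr0.le]
    -- continuity of the two pieces at the boundary points
    have hc1 : ∀ z : ℂ, z ≠ 0 → ContinuousAt G₁ z := by
      intro z hz
      simp only [hG₁, sub_zero]
      exact (((differentiable_const_cpow hx) z).continuousAt).div (continuousAt_id.pow _)
        (pow_ne_zero _ hz)
    have hlogh_diff : ∀ z : ℂ, h z ≠ 0 → DifferentiableAt ℂ (fun s ↦ logDeriv h s * (x : ℂ) ^ s) z := by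
      intro z hz
      have hd : DifferentiableAt ℂ (deriv h) z := ((hh.analyticAt z).deriv).differentiableAt
      have : DifferentiableAt ℂ (fun s ↦ logDeriv h s) z := by
        simp_rw [logDeriv_apply]; exact hd.div (hh z) hz
      exact this.mul ((differentiable_const_cpow hx) z)
    have hc2 : ∀ z : ℂ, z ≠ 0 → h z ≠ 0 → ContinuousAt G₂ z := by
      intro z hz hhz
      simp only [hG₂]
      refine continuousAt_const.mul ?_
      simp only [sub_zero]
      exact ((hlogh_diff z hhz).continuousAt).div continuousAt_id hz
    have hrr : (-r : ℝ) ≤ r := by linarith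
    have hdd : (-δ : ℝ) ≤ δ := by linarith
    rw [Literature.Analysis.Complex.rectBoundaryIntegral_congr (G := fun s ↦ (-(m₀ : ℂ)) * G₁ s + G₂ s) hrr hdd
        (fun t ht ↦ by
          obtain ⟨h1, h2⟩ := hbdry _ (hmem t ht _ (Or.inl rfl)) (Or.inl (by simp))
          exact hsplit _ h1 h2)
        (fun t ht ↦ by
          obtain ⟨h1, h2⟩ := hbdry _ (hmem t ht _ (Or.inr rfl)) (Or.inr (Or.inl (by simp)))
          exact hsplit _ h1 h2)
        (fun y hy ↦ by
          obtain ⟨h1, h2⟩ := hbdry _ (hmem' y hy _ (Or.inl rfl)) (Or.inr (Or.inr (Or.inl (by simp))))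
          exact hsplit _ h1 h2)
        (fun y hy ↦ by
          obtain ⟨h1, h2⟩ := hbdry _ (hmem' y hy _ (Or.inr rfl)) (Or.inr (Or.inr (Or.inr (by simp))))
          exact hsplit _ h1 h2),
      Literature.Analysis.Complex.rectBoundaryIntegral_add (F := fun s ↦ (-(m₀ : ℂ)) * G₁ s) (G := G₂) hrr hdd
        (fun t ht ↦ continuousAt_const.mul (hc1 _ (hbdry _ (hmem t ht _ (Or.inl rfl)) (Or.inl (by simp))).1))
        (fun t ht ↦ continuousAt_const.mul (hc1 _ (hbdry _ (hmem t ht _ (Or.inr rfl)) (Or.inr (Or.inl (by simp)))).1))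
        (fun y hy ↦ continuousAt_const.mul (hc1 _ (hbdry _ (hmem' y hy _ (Or.inl rfl))
          (Or.inr (Or.inr (Or.inl (by simp))))).1))
        (fun y hy ↦ continuousAt_const.mul (hc1 _ (hbdry _ (hmem' y hy _ (Or.inr rfl))
          (Or.inr (Or.inr (Or.inr (by simp))))).1))
        (fun t ht ↦ by
          obtain ⟨h1, h2⟩ := hbdry _ (hmem t ht _ (Or.inl rfl)) (Or.inl (by simp)); exact hc2 _ h1 h2)
        (fun t ht ↦ by
          obtain ⟨h1, h2⟩ := hbdry _ (hmem t ht _ (Or.inr rfl)) (Or.inr (Or.inl (by simp))); exact hc2 _ h1 h2)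
        (fun y hy ↦ by
          obtain ⟨h1, h2⟩ := hbdry _ (hmem' y hy _ (Or.inl rfl)) (Or.inr (Or.inr (Or.inl (by simp))))
          exact hc2 _ h1 h2)
        (fun y hy ↦ by
          obtain ⟨h1, h2⟩ := hbdry _ (hmem' y hy _ (Or.inr rfl)) (Or.inr (Or.inr (Or.inr (by simp))))
          exact hc2 _ h1 h2),
      Literature.Analysis.Complex.rectBoundaryIntegral_const_mul]
    -- `∮ x^s/s² = 2πi log x`
    have hI1 : Literature.Analysis.Complex.rectBoundaryIntegral G₁ (-r) r (-δ) δ =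
        2 * π * I * Real.log x := by
      have h := Literature.Analysis.Complex.rectBoundaryIntegral_div_pow_succ_eq_iteratedDeriv
        (f := fun s : ℂ ↦ (x : ℂ) ^ s) (a := -r) (b := r) (c := -δ) (d := δ) isOpen_univ 0 1
        (by simp [hr0]) (by simp [hr0]) (by simp [hδ0]) (by simp [hδ0]) (subset_univ _)
        (differentiable_const_cpow hx).differentiableOn
      rw [hG₁, h, iteratedDeriv_one]
      have hd : deriv (fun s : ℂ ↦ (x : ℂ) ^ s) 0 = Real.log x := by
        have hx0 : (x : ℂ) ≠ 0 := by exact_mod_cast hx.ne'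
        rw [((hasStrictDerivAt_const_cpow (Or.inl hx0)).hasDerivAt).deriv, cpow_zero, one_mul,
          Complex.ofReal_log hx.le]
      rw [hd]
      simp
    -- `∮ (h'/h) x^s/s = 2πi h'/h(0)`
    have hI2 : Literature.Analysis.Complex.rectBoundaryIntegral G₂ (-r) r (-δ) δ =
        2 * π * I * (-1) * logDeriv h 0 := by
      have hgd : DifferentiableOn ℂ (fun s ↦ logDeriv h s * (x : ℂ) ^ s) (Icc (-r) r ×ℂ Icc (-δ) δ) :=
        fun z hz ↦ (hlogh_diff z (hh_ne z hz)).differentiableWithinAt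
      rw [hG₂, Literature.Analysis.Complex.rectBoundaryIntegral_const_mul_div_sub (-1) 0 (by simp [hr0])
        (by simp [hr0]) (by simp [hδ0]) (by simp [hδ0]) hgd]
      simp
    rw [hI1, hI2]
    ring
  rw [hcenter]
  -- Step 4: the zero sets
  set Zp : Set ℂ := {ρ : ℂ | χ.LFunction ρ = 0 ∧ ρ ∈ Ioo (-(1 / 2) : ℝ) b ×ℂ Ioo δ T} with hZp
  set Zm : Set ℂ := {ρ : ℂ | χ.LFunction ρ = 0 ∧ ρ ∈ Ioo (-(1 / 2) : ℝ) b ×ℂ Ioo (-T) (-δ)} with hZm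
  set Zr : Set ℂ := {ρ : ℂ | χ.LFunction ρ = 0 ∧ ρ ∈ Ioo r b ×ℂ Ioo (-δ) δ} with hZr
  have hZp_sub : Zp ⊆ Z := by
    rintro ρ ⟨h0, ⟨-, -⟩, hi1, hi2⟩
    have him : ρ.im ≠ 0 := by intro h'; rw [h'] at hi1; linarith
    obtain ⟨h1, h2⟩ := re_mem_Ioo_of_LFunction_eq_zero_of_im_ne_zero hprim hχ h0 him
    exact ⟨h0, h1, h2, abs_le.2 ⟨by linarith, hi2.le⟩⟩
  have hZm_sub : Zm ⊆ Z := by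
    rintro ρ ⟨h0, ⟨-, -⟩, hi1, hi2⟩
    have him : ρ.im ≠ 0 := by intro h'; rw [h'] at hi2; linarith
    obtain ⟨h1, h2⟩ := re_mem_Ioo_of_LFunction_eq_zero_of_im_ne_zero hprim hχ h0 him
    exact ⟨h0, h1, h2, abs_le.2 ⟨hi1.le, by linarith⟩⟩
  have hZr_sub : Zr ⊆ Z := by
    rintro ρ ⟨h0, ⟨hr1, -⟩, hi1, hi2⟩
    have hre1 : ρ.re < 1 := by
      by_contra h'
      exact LFunction_ne_zero_of_one_le_re χ (Or.inl hχ) (not_lt.1 h') h0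
    exact ⟨h0, by linarith, hre1, abs_le.2 ⟨by linarith, by linarith⟩⟩
  have hunion : Zp ∪ Zm ∪ Zr = Z := by
    refine Subset.antisymm (union_subset (union_subset hZp_sub hZm_sub) hZr_sub) fun ρ hρ ↦ ?_
    have hρ' : ρ ∈ Z := hρ
    obtain ⟨h0, hre0, hre1, habs⟩ := hρ'
    obtain ⟨hne1, hne2⟩ := hgood ρ h0 hre0 hre1
    have hlt1 : ρ.im < T := lt_of_le_of_ne (abs_le.1 habs).2 hne1
    have hlt2 : -T < ρ.im := lt_of_le_of_ne (abs_le.1 habs).1 (Ne.symm hne2)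
    have hreb : -(1 / 2) < ρ.re ∧ ρ.re < b := ⟨by linarith, by linarith⟩
    rcases hZ1 ρ hρ with him | him
    · -- real zero: `Re ρ > r`
      right
      have hrr : r < ρ.re := by
        by_contra h'
        exact hZ2 ρ hρ ⟨by rw [abs_of_pos hre0]; exact not_lt.1 h', by rw [him, abs_zero]; exact hδ0.le⟩
      exact ⟨h0, ⟨hrr, hreb.2⟩, by rw [him]; linarith, by rw [him]; linarith⟩
    · left
      rcases le_or_gt 0 ρ.im with hi | hi
      · rw [abs_of_nonneg hi] at him
        exact Or.inl ⟨h0, hreb, him, hlt1⟩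
      · rw [abs_of_neg hi] at him
        exact Or.inr ⟨h0, hreb, hlt2, by linarith⟩
  have hdisj1 : Disjoint Zp Zm := by
    rw [Set.disjoint_left]
    rintro ρ ⟨-, -, h1, -⟩ ⟨-, -, -, h2⟩
    linarith
  have hdisj2 : Disjoint (Zp ∪ Zm) Zr := by
    rw [Set.disjoint_left]
    rintro ρ (⟨-, -, h1, -⟩ | ⟨-, -, -, h1⟩) ⟨-, -, h2, h3⟩ <;> linarith
  have hZpf : Zp.Finite := hZfin.subset hZp_sub
  have hZmf : Zm.Finite := hZfin.subset hZm_sub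
  have hZrf : Zr.Finite := hZfin.subset hZr_sub
  have hsum : ∑ᶠ ρ ∈ Zp, f ρ + ∑ᶠ ρ ∈ Zm, f ρ + ∑ᶠ ρ ∈ Zr, f ρ =
      ∑ ρ ∈ hZfin.toFinset, (DirichletDisc.zeroOrder χ ρ : ℂ) * ((x : ℂ) ^ ρ / ρ) := by
    rw [← finsum_mem_union hdisj1 hZpf hZmf, ← finsum_mem_union hdisj2 (hZpf.union hZmf) hZrf, hunion,
      finsum_mem_eq_finite_toFinset_sum _ hZfin]
    refine Finset.sum_congr rfl fun ρ _ ↦ ?_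
    simp only [hf, meromorphicOrderAt_untop₀ hχ]
  rw [← hsum]
  ring

/-! ### The whole rectangle `[−2K−1/2, b] × [−T, T]` -/

/-- At a good height `T > 0` (the ordinate of no non-trivial zero), `L(σ ± iT, χ) ≠ 0` for all `σ`.
[folklore] -/
theorem LFunction_ne_zero_of_abs_im_eq (hprim : χ.IsPrimitive) (hq : 1 < q) {T : ℝ} (hT : 0 < T)
    (hgood : ∀ ρ : ℂ, χ.LFunction ρ = 0 → 0 < ρ.re → ρ.re < 1 → ρ.im ≠ T ∧ ρ.im ≠ -T)
    {s : ℂ} (hs : |s.im| = T) : χ.LFunction s ≠ 0 := by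
  intro h0
  have hχ : χ ≠ 1 := ne_one_of_isPrimitive hprim hq
  have him : s.im ≠ 0 := fun h ↦ by rw [h, abs_zero] at hs; linarith
  obtain ⟨h1, h2⟩ := re_mem_Ioo_of_LFunction_eq_zero_of_im_ne_zero hprim hχ h0 him
  obtain ⟨hne1, hne2⟩ := hgood s h0 h1 h2
  rcases (abs_eq hT.le).1 hs with h | h
  · exact hne1 h
  · exact hne2 h

/-- **The contour identity.** For a primitive `χ` mod `q > 1` with Gamma factor `Γ_ℝ(s + a)`,
`x > 0`, `b > 1`, `K ≥ 1`, a height `T ≥ 1` which is `±` no ordinate of a non-trivial zero, and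
`L(s, χ) = s^{m₀} h(s)` with `h` entire, `h(0) ≠ 0`:
`∮_{∂([−2K−1/2, b] × [−T, T])} (−L'/L)(s, χ) x^s/s ds =
  2πi (−∑_{|Im ρ| ≤ T} m(ρ) x^ρ/ρ − (m₀ log x + h'/h(0)) + ∑_{k<K} x^{−(2k+2−a)}/(2k+2−a))`.
[cite: MontgomeryVaughan2007, Thm. 12.10 (proof)] -/
theorem contour_identity (hprim : χ.IsPrimitive) (hq : 1 < q) {x b T : ℝ} (hx : 0 < x) (hb : 1 < b)
    (hT : 1 ≤ T)
    (hgood : ∀ ρ : ℂ, χ.LFunction ρ = 0 → 0 < ρ.re → ρ.re < 1 → ρ.im ≠ T ∧ ρ.im ≠ -T)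
    {m₀ : ℕ} {h : ℂ → ℂ} (hh : Differentiable ℂ h) (hh0 : h 0 ≠ 0)
    (hLh : ∀ s : ℂ, χ.LFunction s = s ^ m₀ * h s) {a : ℝ} (ha : a = 0 ∨ a = 1)
    (hGa : ∀ s : ℂ, gammaFactor χ s = Gammaℝ (s + a)) {K : ℕ} (hK : 1 ≤ K) :
    Literature.Analysis.Complex.rectBoundaryIntegral
        (fun s : ℂ ↦ (-logDeriv χ.LFunction s) * ((x : ℂ) ^ s / s))
        (-(2 * (K : ℝ)) - 1 / 2) b (-T) T =
      2 * π * I * (-(∑ ρ ∈ (lfunctionZeroBox_finite (ne_one_of_isPrimitive hprim hq) T).toFinset,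
          (DirichletDisc.zeroOrder χ ρ : ℂ) * ((x : ℂ) ^ ρ / ρ)) -
        ((m₀ : ℂ) * Real.log x + logDeriv h 0) +
        ∑ k ∈ Finset.range K, (x : ℂ) ^ (-(2 * (k : ℂ) + 2 - a)) / (2 * (k : ℂ) + 2 - a)) := by
  have hχ : χ ≠ 1 := ne_one_of_isPrimitive hprim hq
  have hT0 : (0 : ℝ) < T := by linarith
  have hK1 : (1 : ℝ) ≤ K := by exact_mod_cast hK
  -- continuity on the horizontal edges `Im s = ±T` (all `σ`)
  have hcont : ∀ (y : ℝ), (y = -T ∨ y = T) → ∀ t : ℝ,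
      ContinuousAt (fun s : ℂ ↦ (-logDeriv χ.LFunction s) * ((x : ℂ) ^ s / s)) ((t : ℂ) + y * I) := by
    intro y hy t
    have hy0 : y ≠ 0 := by rcases hy with rfl | rfl <;> simp [hT0.ne']
    refine continuousAt_integrand hχ hx (LFunction_ne_zero_of_abs_im_eq hprim hq hT0 hgood ?_) ?_
    · simp; rcases hy with rfl | rfl
      · rw [abs_neg, abs_of_pos hT0]
      · rw [abs_of_pos hT0]
    · intro h; exact hy0 (by simpa using congrArg Complex.im h)
  have hih : ∀ (y : ℝ), (y = -T ∨ y = T) → ∀ c d : ℝ, c ≤ d →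
      IntervalIntegrable (fun t : ℝ ↦ (fun s : ℂ ↦ (-logDeriv χ.LFunction s) * ((x : ℂ) ^ s / s))
        ((t : ℂ) + y * I)) volume c d := fun y hy c d hcd ↦
    Literature.Analysis.Complex.intervalIntegrable_of_continuousAt_horizontal y hcd fun t _ ↦ hcont y hy t
  have ha' : -(2 * (K : ℝ)) - 1 / 2 ≤ -(1 / 2) := by linarith
  have hb' : (-(1 / 2) : ℝ) ≤ b := by linarith
  rw [rectBoundaryIntegral_vsplit (e := -(1 / 2)) (hih _ (Or.inl rfl) _ _ ha') (hih _ (Or.inl rfl) _ _ hb')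
      (hih _ (Or.inr rfl) _ _ ha') (hih _ (Or.inr rfl) _ _ hb'),
    contour_identity_left hprim hq hx hK hT ha hGa,
    contour_identity_right hprim hq hx hb hT hgood hh hh0 hLh]
  ring

/-! ### The trivial zeros: the series `∑_k x^{−(2k+2−a)}/(2k+2−a)` -/

/-- **The sum over the trivial zeros, even case** (`a = 0`, `x > 1`):
`∑_{k≥0} x^{−(2k+2)}/(2k+2) = −½ log(1 − 1/x²)`. [cite: MontgomeryVaughan2007, (12.6)] -/
theorem hasSum_trivialZeroTerm_even {x : ℝ} (hx : 1 < x) :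
    HasSum (fun k : ℕ ↦ (x : ℂ) ^ (-(2 * (k : ℂ) + 2 - ((0 : ℝ) : ℂ))) / (2 * (k : ℂ) + 2 - ((0 : ℝ) : ℂ)))
      (((-(1 / 2) * Real.log (1 - 1 / x ^ 2) : ℝ) : ℂ)) := by
  have h := hasSum_trivialZeroTerm hx
  refine h.congr_fun fun k ↦ ?_
  push_cast
  ring_nf

/-- `x^{−(2k+1)} = (x⁻¹)^{2k+1}` as a real number cast to `ℂ` (`x > 0`). [folklore] -/
theorem cpow_trivialZero_odd {x : ℝ} (hx : 0 < x) (k : ℕ) :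
    (x : ℂ) ^ (-(2 * (k : ℂ) + 2 - ((1 : ℝ) : ℂ))) = ((((x⁻¹) ^ (2 * k + 1)) : ℝ) : ℂ) := by
  have hx0 : (x : ℂ) ≠ 0 := by exact_mod_cast hx.ne'
  have : (-(2 * (k : ℂ) + 2 - ((1 : ℝ) : ℂ))) = ((-((2 * k + 1 : ℕ) : ℤ) : ℤ) : ℂ) := by push_cast; ring
  rw [this, cpow_intCast, zpow_neg, zpow_natCast]
  push_cast
  rw [inv_pow]

/-- **The sum over the trivial zeros, odd case** (`a = 1`, `x > 1`):
`∑_{k≥0} x^{−(2k+1)}/(2k+1) = ½ (log(1 + 1/x) − log(1 − 1/x))`. [cite: MontgomeryVaughan2007, (12.6)] -/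
theorem hasSum_trivialZeroTerm_odd {x : ℝ} (hx : 1 < x) :
    HasSum (fun k : ℕ ↦ (x : ℂ) ^ (-(2 * (k : ℂ) + 2 - ((1 : ℝ) : ℂ))) / (2 * (k : ℂ) + 2 - ((1 : ℝ) : ℂ)))
      (((1 / 2 * (Real.log (1 + 1 / x) - Real.log (1 - 1 / x)) : ℝ) : ℂ)) := by
  have hx0 : 0 < x := by linarith
  set u : ℝ := x⁻¹ with hu
  have hu0 : 0 < u := by positivity
  have hu1 : u < 1 := inv_lt_one_of_one_lt₀ hx
  have hreal : HasSum (fun k : ℕ ↦ (2 : ℝ) * (1 / (2 * k + 1)) * u ^ (2 * k + 1) * (1 / 4))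
      ((Real.log (1 + u) - Real.log (1 - u)) * (1 / 4)) :=
    (Real.hasSum_log_sub_log_of_abs_lt_one (by rw [abs_of_pos hu0]; exact hu1)).mul_right _
  have hC := Complex.hasSum_ofReal.2 hreal
  rw [show (((1 / 2 * (Real.log (1 + 1 / x) - Real.log (1 - 1 / x))) : ℝ) : ℂ) =
    (((Real.log (1 + u) - Real.log (1 - u)) * (1 / 4) : ℝ) : ℂ) * 2 by
      rw [hu, one_div x]; push_cast; ring]
  refine (hC.mul_right 2).congr_fun fun k ↦ ?_
  rw [cpow_trivialZero_odd hx0 k, ← hu]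
  have hk : (2 * (k : ℂ) + 2 - ((1 : ℝ) : ℂ)) ≠ 0 := by
    have : (((2 * (k : ℝ) + 1) : ℝ) : ℂ) ≠ 0 := by
      exact_mod_cast (by positivity : (2 * (k : ℝ) + 1) ≠ 0)
    push_cast at this ⊢
    ring_nf at this ⊢
    exact this
  push_cast
  field_simp
  ring

/-! ### The far-left edge tends to `0` -/

/-- **The far-left edge.** For a primitive `χ` mod `q > 1`, `x > 1`, `T ≥ 1`:
`∫_{-T}^{T} (−L'/L)(a_K+it, χ) x^{a_K+it}/(a_K+it) dt → 0` as `K → ∞`, `a_K = −2K − 1/2`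
(`|L'/L| ≤ A + log q + 6K + 2|t|` there and `|x^s/s| ≤ x^{a_K}/|a_K|`).
[cite: MontgomeryVaughan2007, Thm. 12.10 (proof)] -/
theorem tendsto_farLeft (hprim : χ.IsPrimitive) (hq : 1 < q) {x T : ℝ} (hx : 1 < x) (hT : 1 ≤ T) :
    Tendsto (fun K : ℕ ↦ ∫ t in (-T)..T,
      (fun s : ℂ ↦ (-logDeriv χ.LFunction s) * ((x : ℂ) ^ s / s))
        ((((-(2 * (K : ℝ)) - 1 / 2 : ℝ)) : ℂ) + t * I)) atTop (𝓝 0) := by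
  have hx0 : 0 < x := by linarith
  have hT0 : 0 < T := by linarith
  obtain ⟨A, hA0, hA⟩ := exists_norm_logDeriv_LFunction_farLeft_le
  have hq1 : (1 : ℝ) ≤ q := by exact_mod_cast (le_of_lt hq)
  have hlogq : 0 ≤ Real.log q := Real.log_nonneg hq1
  set B : ℝ := 2 * (A + Real.log q + 2 * T) + 3 with hB
  have hB0 : 0 ≤ B := by positivity
  set r : ℝ := (x ^ 2)⁻¹ with hr
  have hr0 : 0 ≤ r := by positivity
  have hr1 : r < 1 := inv_lt_one_of_one_lt₀ (by nlinarith)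
  have hbound : ∀ K : ℕ, 1 ≤ K → ‖∫ t in (-T)..T,
      (fun s : ℂ ↦ (-logDeriv χ.LFunction s) * ((x : ℂ) ^ s / s))
        ((((-(2 * (K : ℝ)) - 1 / 2 : ℝ)) : ℂ) + t * I)‖ ≤
      B * x ^ (-(1 / 2) : ℝ) * r ^ K * (2 * T) := by
    intro K hK
    have hK1 : (1 : ℝ) ≤ K := by exact_mod_cast hK
    set a : ℝ := -(2 * (K : ℝ)) - 1 / 2 with ha
    have ha0 : a ≠ 0 := by rw [ha]; linarith
    have haabs : |a| = 2 * K + 1 / 2 := by rw [ha, abs_of_neg (by linarith)]; ring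
    have hxa : x ^ a = x ^ (-(1 / 2) : ℝ) * r ^ K := by
      have h1 : x ^ (-(2 * (K : ℝ))) = r ^ K := by
        rw [Real.rpow_neg hx0.le, Real.rpow_mul hx0.le, Real.rpow_two, Real.rpow_natCast, hr, inv_pow]
      rw [ha, show -(2 * (K : ℝ)) - 1 / 2 = -(1 / 2) + -(2 * (K : ℝ)) by ring, Real.rpow_add hx0, h1]
    have hpt : ∀ t ∈ Ι (-T) T, ‖(fun s : ℂ ↦ (-logDeriv χ.LFunction s) * ((x : ℂ) ^ s / s))
        (((a : ℝ) : ℂ) + t * I)‖ ≤ B * x ^ (-(1 / 2) : ℝ) * r ^ K := by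
      intro t ht
      have htT : |t| ≤ T := by
        rw [Set.mem_uIoc] at ht
        rcases ht with ⟨h1, h2⟩ | ⟨h1, h2⟩
        · exact abs_le.2 ⟨by linarith, h2⟩
        · linarith
      have h1 := (hA q χ hprim hq K hK t).2
      rw [← ha] at h1
      have h2 := norm_cpow_div_le_vertical hx0 ha0 t
      rw [haabs] at h2
      show ‖(-logDeriv χ.LFunction (((a : ℝ) : ℂ) + t * I)) *
        ((x : ℂ) ^ (((a : ℝ) : ℂ) + t * I) / (((a : ℝ) : ℂ) + t * I))‖ ≤ _
      rw [norm_mul, norm_neg]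
      have h1' : ‖logDeriv χ.LFunction (((a : ℝ) : ℂ) + t * I)‖ ≤ B * (2 * K + 1 / 2) := by
        refine h1.trans ?_
        rw [hB]
        nlinarith
      calc ‖logDeriv χ.LFunction (((a : ℝ) : ℂ) + t * I)‖ *
            ‖(x : ℂ) ^ (((a : ℝ) : ℂ) + t * I) / (((a : ℝ) : ℂ) + t * I)‖
          ≤ (B * (2 * K + 1 / 2)) * (x ^ a / (2 * K + 1 / 2)) :=
            mul_le_mul h1' h2 (norm_nonneg _) (by positivity)
        _ = B * x ^ (-(1 / 2) : ℝ) * r ^ K := by rw [hxa]; field_simp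
    have h := intervalIntegral.norm_integral_le_of_norm_le_const hpt
    rw [show |T - -T| = 2 * T by rw [sub_neg_eq_add, abs_of_nonneg (by linarith)]; ring] at h
    exact h
  have hlim : Tendsto (fun K : ℕ ↦ B * x ^ (-(1 / 2) : ℝ) * r ^ K * (2 * T)) atTop (𝓝 0) := by
    have h2 := tendsto_pow_atTop_nhds_zero_of_lt_one hr0 hr1
    simpa using ((h2.const_mul (B * x ^ (-(1 / 2) : ℝ))).mul_const (2 * T))
  refine squeeze_zero_norm' ?_ hlim
  filter_upwards [eventually_ge_atTop 1] with K hK using hbound K hK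

/-! ### The identity for the right edge: `K → ∞` -/

/-- **The identity for the right edge** (`K → ∞`). Let `χ` be primitive mod `q > 1` with Gamma factor
`Γ_ℝ(s + a)`, `x > 1`, `b > 1`, `T ≥ 1` a height which is `±` no ordinate of a non-trivial zero,
`L(s, χ) = s^{m₀} h(s)` (`h` entire, `h(0) ≠ 0`), `∑_k x^{−(2k+2−a)}/(2k+2−a) = V`, and assume the
integrand `G(s) = (−L'/L)(s, χ) x^s/s` is integrable on the two half-lines `(−∞, b] ± iT`. Then
`i ∫_{-T}^{T} G(b+it) dt = 2πi (−∑_{|Im ρ| ≤ T} m(ρ)x^ρ/ρ − (m₀ log x + h'/h(0)) + V)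
  − ∫_{−∞}^{b} G(σ − iT) dσ + ∫_{−∞}^{b} G(σ + iT) dσ`.
[cite: MontgomeryVaughan2007, Thm. 12.10 (proof)] -/
theorem rightEdge_identity (hprim : χ.IsPrimitive) (hq : 1 < q) {x b T : ℝ} (hx : 1 < x) (hb : 1 < b)
    (hT : 1 ≤ T)
    (hgood : ∀ ρ : ℂ, χ.LFunction ρ = 0 → 0 < ρ.re → ρ.re < 1 → ρ.im ≠ T ∧ ρ.im ≠ -T)
    {m₀ : ℕ} {h : ℂ → ℂ} (hh : Differentiable ℂ h) (hh0 : h 0 ≠ 0)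
    (hLh : ∀ s : ℂ, χ.LFunction s = s ^ m₀ * h s) {a : ℝ} (ha : a = 0 ∨ a = 1)
    (hGa : ∀ s : ℂ, gammaFactor χ s = Gammaℝ (s + a)) {V : ℂ}
    (hV : HasSum (fun k : ℕ ↦ (x : ℂ) ^ (-(2 * (k : ℂ) + 2 - a)) / (2 * (k : ℂ) + 2 - a)) V)
    (hint_top : IntegrableOn (fun σ : ℝ ↦
      (fun s : ℂ ↦ (-logDeriv χ.LFunction s) * ((x : ℂ) ^ s / s)) ((σ : ℂ) + T * I)) (Iic b))
    (hint_bot : IntegrableOn (fun σ : ℝ ↦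
      (fun s : ℂ ↦ (-logDeriv χ.LFunction s) * ((x : ℂ) ^ s / s)) ((σ : ℂ) + (-T : ℝ) * I)) (Iic b)) :
    I * ∫ t in (-T)..T,
        (fun s : ℂ ↦ (-logDeriv χ.LFunction s) * ((x : ℂ) ^ s / s)) ((b : ℂ) + t * I) =
      2 * π * I * (-(∑ ρ ∈ (lfunctionZeroBox_finite (ne_one_of_isPrimitive hprim hq) T).toFinset,
          (DirichletDisc.zeroOrder χ ρ : ℂ) * ((x : ℂ) ^ ρ / ρ)) -
        ((m₀ : ℂ) * Real.log x + logDeriv h 0) + V) -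
      (∫ σ in Iic b,
        (fun s : ℂ ↦ (-logDeriv χ.LFunction s) * ((x : ℂ) ^ s / s)) ((σ : ℂ) + (-T : ℝ) * I)) +
      ∫ σ in Iic b,
        (fun s : ℂ ↦ (-logDeriv χ.LFunction s) * ((x : ℂ) ^ s / s)) ((σ : ℂ) + T * I) := by
  have hx0 : 0 < x := by linarith
  set G : ℂ → ℂ := fun s ↦ (-logDeriv χ.LFunction s) * ((x : ℂ) ^ s / s) with hG
  set aK : ℕ → ℝ := fun K ↦ -(2 * (K : ℝ)) - 1 / 2 with haK
  set W : ℂ := ∫ t in (-T)..T, G ((b : ℂ) + t * I) with hW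
  set Res : ℂ := -(∑ ρ ∈ (lfunctionZeroBox_finite (ne_one_of_isPrimitive hprim hq) T).toFinset,
      (DirichletDisc.zeroOrder χ ρ : ℂ) * ((x : ℂ) ^ ρ / ρ)) - ((m₀ : ℂ) * Real.log x + logDeriv h 0)
    with hRes
  set Zs : ℕ → ℂ := fun K ↦ ∑ k ∈ Finset.range K, (x : ℂ) ^ (-(2 * (k : ℂ) + 2 - a)) / (2 * (k : ℂ) + 2 - a)
    with hZs
  set Hbot : ℕ → ℂ := fun K ↦ ∫ σ in (aK K)..b, G ((σ : ℂ) + (-T : ℝ) * I) with hHbot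
  set Htop : ℕ → ℂ := fun K ↦ ∫ σ in (aK K)..b, G ((σ : ℂ) + T * I) with hHtop
  set Vleft : ℕ → ℂ := fun K ↦ ∫ t in (-T)..T, G (((aK K : ℝ) : ℂ) + t * I) with hVleft
  -- the identity at level `K`
  have hK : ∀ K : ℕ, 1 ≤ K → I * W = 2 * π * I * (Res + Zs K) - Hbot K + Htop K + I * Vleft K := by
    intro K hK1
    have h := contour_identity hprim hq hx0 hb hT hgood hh hh0 hLh ha hGa hK1
    rw [Literature.Analysis.Complex.rectBoundaryIntegral] at h
    have h' : Hbot K - Htop K + I * W - I * Vleft K = 2 * π * I * (Res + Zs K) := by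
      rw [hHbot, hHtop, hW, hVleft, hRes, hZs]
      simp only [haK]
      push_cast at h ⊢
      linear_combination h
    linear_combination h'
  -- the limits
  have hlimZ : Tendsto Zs atTop (𝓝 V) := hV.tendsto_sum_nat
  have hlimbot : Tendsto Hbot atTop (𝓝 (∫ σ in Iic b, G ((σ : ℂ) + (-T : ℝ) * I))) :=
    intervalIntegral_tendsto_integral_Iic b hint_bot tendsto_leftAbscissa
  have hlimtop : Tendsto Htop atTop (𝓝 (∫ σ in Iic b, G ((σ : ℂ) + T * I))) :=
    intervalIntegral_tendsto_integral_Iic b hint_top tendsto_leftAbscissa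
  have hlimleft : Tendsto Vleft atTop (𝓝 0) := tendsto_farLeft hprim hq hx hT
  have hlim : Tendsto (fun K ↦ 2 * π * I * (Res + Zs K) - Hbot K + Htop K + I * Vleft K) atTop
      (𝓝 (2 * π * I * (Res + V) -
        (∫ σ in Iic b, G ((σ : ℂ) + (-T : ℝ) * I)) + (∫ σ in Iic b, G ((σ : ℂ) + T * I)) + I * 0)) :=
    ((((hlimZ.const_add Res).const_mul (2 * π * I)).sub hlimbot).add hlimtop).add
      (hlimleft.const_mul I)
  rw [mul_zero, add_zero] at hlim
  have hconst : Tendsto (fun _ : ℕ ↦ I * W) atTop (𝓝 (I * W)) := tendsto_const_nhds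
  have heq : (fun K ↦ 2 * π * I * (Res + Zs K) - Hbot K + Htop K + I * Vleft K) =ᶠ[atTop]
      fun _ : ℕ ↦ I * W := by
    filter_upwards [eventually_ge_atTop 1] with K hK1 using (hK K hK1).symm
  have := tendsto_nhds_unique (hlim.congr' heq) hconst
  refine this.symm.trans ?_
  ring

end ExplicitPsiChar

end Literature.NumberTheory.LFunctions

end
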